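import Mathlib
import Summits.ValiantsHypothesis.ValiantsHypothesis.Theses.ValuativeGCT
import Literature.NumberTheory.DiophantineGeometry.SchurWeylPlethysmKroneckerBoundProofs

/-!
# `ValuativeGCT.ValuativeFlip` (stmt-ValiantsHypothesis-12624), axis D (det-orbit-closure multiplicity
# bounds for the det census) — the transpose symmetry of `det_m` in the word model

Wall-breaker k11 (gen 1, seat 4).  DECOMPOSITIONS.md §1 D4 asks for the SYMMETRIC Kronecker bound
`K_m(λ*) ≤ dim T_U(λ) ≤ dim T₀(λ) ≤ sk(λ; m × δ)` of BLMW 2011 Prop. 5.2.1 / (5.2.5); the tree has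
the Kronecker bound `≤ g(λ, m×δ, m×δ)` only (`orbitMultiplicity_det_le_kroneckerCoeff_holds`, H2
`stub_truncT0_le_kronecker`), obtained from the stabilising family `a ⊗ b` (`a, b` upper triangular
unimodular).  This file adds the second generator of `Stab(det_m) = S(GL(E)×GL(F)) ⋊ ℤ/2`, the
TRANSPOSE, to that family, in the word model of `SchurWeylPlethysmKroneckerBoundProofs`:

* `letterSwap m : Equiv.Perm (Fin (m*m))`, the transposition `(a, b) ↦ (b, a)` of the alphabet
  `Fin (m*m) ≃ Fin m × Fin m`, and `swapGL k m ∈ GL_{m²}(k)`, its permutation matrix;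
* its action on `W^{⊗D}` swaps the two component words (`splitFun_wordRep_swapGL`), hence preserves
  the Kronecker invariants (`wordRep_swapGL_mem_kronInvariants`);
* the **symmetric Kronecker invariants** `symKronInvariants k m D` = Kronecker invariants fixed by
  the swap (an `𝔖_D`-stable subspace, `wordPerm_mem_symKronInvariants`);
* reindexed to `MatIdx m`, `swapGL` is the permutation matrix of `X ↦ Xᵀ` and fixes `det_m`
  (`linSubstRep_reindexGL_swapGL_detFormLex`, `det Xᵀ = det X` over any field);
* hence (`finrank_highestWeightSpace_orbitCoordRep_le` with the family enlarged by the swap)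
  **`K_m(λ*) ≤ dim boundSpace(λ*, symKronInvariants)`** (`orbitMultiplicity_det_le_finrank_symBoundSpace`).

The character computation `2·D!·dim boundSpace(λ*, symKronInvariants) = Σ_τ χ^λ(τ)(χ^□(τ)² + χ^□(τ²))`
(`= skCharSum λ □ = 2·D!·sk(λ, □)`) is the sequel file `…SymKroneckerCharacter`.

Sources: P. Bürgisser, J. M. Landsberg, L. Manivel, J. Weyman, SIAM J. Comput. 40 (2011) §5.2,
Prop. 5.2.1 and (5.2.5) [BLMW2011]; G. Frobenius 1897 (the transpose in `Stab(det)`).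
No new named facts; definitions are model definitions (the swap, its matrix, the fixed space).
-/

namespace Summit.ValiantsHypothesis.ValiantsHypothesis.Theorems.ValuativeFlip

open Literature.NumberTheory.DiophantineGeometry Literature.Computability.AlgebraicComplexity
open MvPolynomial
open scoped BigOperators Matrix

-- `Summit.ValiantsHypothesis.ValiantsHypothesis.…` is the tree's mandated single-conjunct layout (Sub = Summit).
set_option linter.dupNamespace false

noncomputable section

/-! ## §1 The letter swap on the alphabet `Fin (m*m) ≃ Fin m × Fin m` -/

section Swap

variable (m : ℕ)

/-- The transposition of the alphabet `Fin (m*m) ≃ Fin m × Fin m` (row-major, `finProdFinEquiv`):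
`(a, b) ↦ (b, a)`, i.e. the basis permutation of `W = E ⊗ F ≅ k^{m×m}` underlying `X ↦ Xᵀ`.
[folklore] -/
def letterSwap : Equiv.Perm (Fin (m * m)) :=
  finProdFinEquiv.symm.trans ((Equiv.prodComm (Fin m) (Fin m)).trans finProdFinEquiv)

/-- `letterSwap` on a merged pair of letters swaps the pair. [folklore] -/
@[simp]
theorem letterSwap_finProdFinEquiv (p : Fin m × Fin m) :
    letterSwap m (finProdFinEquiv p) = finProdFinEquiv p.swap := by
  simp [letterSwap]

/-- The components of a swapped letter are the swapped components. [folklore] -/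
@[simp]
theorem finProdFinEquiv_symm_letterSwap (i : Fin (m * m)) :
    finProdFinEquiv.symm (letterSwap m i) = (finProdFinEquiv.symm i).swap := by
  simp [letterSwap]

/-- `letterSwap` is an involution. [folklore] -/
@[simp]
theorem letterSwap_letterSwap (i : Fin (m * m)) : letterSwap m (letterSwap m i) = i := by
  apply finProdFinEquiv.symm.injective
  rw [finProdFinEquiv_symm_letterSwap, finProdFinEquiv_symm_letterSwap, Prod.swap_swap]

/-- `letterSwap` is its own inverse. [folklore] -/
theorem letterSwap_symm : (letterSwap m).symm = letterSwap m := by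
  ext i : 1
  rw [Equiv.symm_apply_eq, letterSwap_letterSwap]

/-- `letterSwap² = 1`. [folklore] -/
theorem letterSwap_mul_self : letterSwap m * letterSwap m = 1 := by
  ext i : 1
  simp [Equiv.Perm.mul_apply]

variable (k : Type*) [Field k]

/-- The permutation matrix of the letter swap as an element of `GL_{m²}(k)` (it is its own inverse).
This is the transpose `X ↦ Xᵀ` of `W = k^{m×m}`, the generator of `Stab(det_m)` outside
`S(GL(E) × GL(F))` (Frobenius 1897; BLMW 2011 §5.2). [folklore] -/
def swapGL : GL (Fin (m * m)) k where
  val := (letterSwap m).permMatrix k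
  inv := (letterSwap m).permMatrix k
  val_inv := by rw [← Matrix.permMatrix_mul, letterSwap_mul_self, Matrix.permMatrix_one]
  inv_val := by rw [← Matrix.permMatrix_mul, letterSwap_mul_self, Matrix.permMatrix_one]

/-- The matrix of `swapGL` (unfolding lemma). [folklore] -/
@[simp]
theorem coe_swapGL : ((swapGL m k : GL (Fin (m * m)) k) : Matrix (Fin (m * m)) (Fin (m * m)) k) =
    (letterSwap m).permMatrix k :=
  rfl

/-- Entries of the swap matrix: `P i j = [letterSwap i = j]`. [folklore] -/
theorem swapGL_apply (i j : Fin (m * m)) :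
    ((swapGL m k : GL (Fin (m * m)) k) : Matrix (Fin (m * m)) (Fin (m * m)) k) i j =
      if letterSwap m i = j then 1 else 0 := by
  simp only [coe_swapGL, Equiv.Perm.permMatrix, PEquiv.toMatrix_apply, Equiv.toPEquiv_apply,
    Option.mem_def, Option.some.injEq]

variable {m k} {D : ℕ}

/-- **The swap acts on `W^{⊗D}` by swapping every letter**: `(P · x)(w) = x (letterSwap ∘ w)`.
[folklore] -/
theorem wordRep_swapGL_apply (x : Word (m * m) D → k) (w : Word (m * m) D) :
    wordRep k (m * m) D (swapGL m k) x w = x (letterSwap m ∘ w) := by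
  classical
  rw [wordRep_apply, Finset.sum_eq_single (letterSwap m ∘ w)]
  · have h1 : (∏ p, ((swapGL m k : GL (Fin (m * m)) k) : Matrix (Fin (m * m)) (Fin (m * m)) k)
        (w p) ((letterSwap m ∘ w) p)) = 1 :=
      Finset.prod_eq_one fun p _ => by rw [swapGL_apply]; exact if_pos rfl
    rw [h1, one_mul]
  · intro u _ hu
    obtain ⟨p, hp⟩ : ∃ p, u p ≠ letterSwap m (w p) := Function.ne_iff.mp hu
    rw [Finset.prod_eq_zero (Finset.mem_univ p) (by rw [swapGL_apply, if_neg (Ne.symm hp)]),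
      zero_mul]
  · exact fun h => absurd (Finset.mem_univ _) h

/-- The swap is an involution on `W^{⊗D}`. [folklore] -/
theorem wordRep_swapGL_wordRep_swapGL (x : Word (m * m) D → k) :
    wordRep k (m * m) D (swapGL m k) (wordRep k (m * m) D (swapGL m k) x) = x := by
  funext w
  rw [wordRep_swapGL_apply, wordRep_swapGL_apply]
  congr 1
  funext p
  simp

/-- Swapping every letter of a merged pair of words merges the swapped pair. [folklore] -/
theorem letterSwap_comp_splitWord_symm (u v : Word m D) :
    letterSwap m ∘ (splitWord m D).symm (u, v) = (splitWord m D).symm (v, u) := by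
  funext p
  simp only [Function.comp_apply, splitWord_symm_apply, letterSwap_finProdFinEquiv, Prod.swap_prod_mk]

/-- **In the pair-of-words picture the swap exchanges the two words**:
`splitFun (P · x) (u, v) = splitFun x (v, u)` (`X ↦ Xᵀ` on `E ⊗ F`-words). [folklore] -/
theorem splitFun_wordRep_swapGL (x : Word (m * m) D → k) (u v : Word m D) :
    splitFun k m D (wordRep k (m * m) D (swapGL m k) x) (u, v) = splitFun k m D x (v, u) := by
  rw [splitFun_apply, wordRep_swapGL_apply, letterSwap_comp_splitWord_symm, splitFun_apply]

/-- **The swap preserves the Kronecker invariants** (it exchanges rows and columns of the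
pair-of-words function, and both are cut out by the same unimodular Borel invariance). BLMW 2011
§5.2 (`ℤ/2 ⊂ Stab(det)` normalises `SL(E) × SL(F)`). [folklore] -/
theorem wordRep_swapGL_mem_kronInvariants {x : Word (m * m) D → k}
    (hx : x ∈ kronInvariants k m D) :
    wordRep k (m * m) D (swapGL m k) x ∈ kronInvariants k m D := by
  rw [mem_kronInvariants_iff_slices] at hx ⊢
  refine ⟨fun v => ?_, fun u => ?_⟩
  · have h := hx.2 v
    simp only [splitFun_wordRep_swapGL]
    exact h
  · have h := hx.1 u
    simp only [splitFun_wordRep_swapGL]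
    exact h

/-- The swap commutes with the permutations of the positions. [folklore] -/
theorem wordPerm_wordRep_swapGL (τ : Equiv.Perm (Fin D)) (x : Word (m * m) D → k) :
    wordPerm k τ (wordRep k (m * m) D (swapGL m k) x) =
      wordRep k (m * m) D (swapGL m k) (wordPerm k τ x) :=
  wordPerm_wordRep k τ _ x

end Swap

/-! ## §2 The symmetric Kronecker invariants -/

section SymKron

variable (k : Type*) [Field k] (m D : ℕ)

/-- The **symmetric Kronecker invariants** of `W^{⊗D}`, `W = E ⊗ F = k^{m×m}` (word model): vectors
fixed by every `a ⊗ b` (`a, b` upper triangular unimodular) AND by the transpose `swapGL`. Under the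
word splitting these are the SYMMETRIC functions of pairs of words with all slices in `HW_□`, i.e.
`S²(HW_□) ⊂ HW_□ ⊗ HW_□`; their `𝔖_D`-character is `(χ^□(τ)² + χ^□(τ²))/2` (sequel file).
BLMW 2011 §5.2 (the symmetric Kronecker coefficient `sk`). [folklore] -/
def symKronInvariants : Submodule k (Word (m * m) D → k) where
  carrier := {x | x ∈ kronInvariants k m D ∧ wordRep k (m * m) D (swapGL m k) x = x}
  add_mem' {x y} hx hy := ⟨Submodule.add_mem _ hx.1 hy.1, by rw [map_add, hx.2, hy.2]⟩
  zero_mem' := ⟨Submodule.zero_mem _, by rw [map_zero]⟩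
  smul_mem' c {x} hx := ⟨Submodule.smul_mem _ c hx.1, by rw [map_smul, hx.2]⟩

variable {k m D}

/-- Membership in `symKronInvariants` (unfolding lemma). [folklore] -/
theorem mem_symKronInvariants_iff (x : Word (m * m) D → k) :
    x ∈ symKronInvariants k m D ↔
      x ∈ kronInvariants k m D ∧ wordRep k (m * m) D (swapGL m k) x = x :=
  Iff.rfl

/-- `symKronInvariants ≤ kronInvariants`. [folklore] -/
theorem symKronInvariants_le_kronInvariants : symKronInvariants k m D ≤ kronInvariants k m D :=
  fun _ hx => hx.1

/-- The symmetric Kronecker invariants are stable under the permutations of the positions.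
[folklore] -/
theorem wordPerm_mem_symKronInvariants (τ : Equiv.Perm (Fin D)) {x : Word (m * m) D → k}
    (hx : x ∈ symKronInvariants k m D) : wordPerm k τ x ∈ symKronInvariants k m D :=
  ⟨wordPerm_mem_kronInvariants k m τ hx.1, by rw [← wordPerm_wordRep_swapGL, hx.2]⟩

/-- The symmetrisation `x + P·x` of a Kronecker invariant is a symmetric Kronecker invariant.
[folklore] -/
theorem add_wordRep_swapGL_mem_symKronInvariants {x : Word (m * m) D → k}
    (hx : x ∈ kronInvariants k m D) :
    x + wordRep k (m * m) D (swapGL m k) x ∈ symKronInvariants k m D :=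
  ⟨Submodule.add_mem _ hx (wordRep_swapGL_mem_kronInvariants hx),
    by rw [map_add, wordRep_swapGL_wordRep_swapGL, add_comm]⟩

/-- Vectors fixed by the enlarged family "`a ⊗ b` (`a, b` upper triangular unimodular) or the
transpose" lie in `symKronInvariants` (BLMW 2011 §5.2: `Stab(det_m) = S(GL(E) × GL(F)) ⋊ ℤ/2`).
[folklore] -/
theorem mem_symKronInvariants_of_forall (x : Word (m * m) D → k)
    (hx : ∀ h, (IsKronUnimodularBorel k m h ∨ h = swapGL m k) → wordRep k (m * m) D h x = x) :
    x ∈ symKronInvariants k m D :=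
  ⟨mem_kronInvariants_of_forall k m x fun h hh => hx h (Or.inl hh), hx _ (Or.inr rfl)⟩

end SymKron

/-! ## §3 The transpose fixes `det_m` -/

section Det

variable (k : Type*) [Field k] (m : ℕ)

/-- Reindexed to `MatIdx m` along `matIdxEquiv`, the swap matrix is the permutation matrix of the
transposition `(a, b) ↦ (b, a)`: entry `(l, i)` is `[l = (i₂, i₁)]`. [folklore] -/
theorem coe_reindexGL_swapGL :
    ((reindexGL (k := k) (matIdxEquiv m) (swapGL m k) : GL (MatIdx m) k) :
        Matrix (MatIdx m) (MatIdx m) k) =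
      Matrix.of fun l i : MatIdx m => if l = toLex ((ofLex i).2, (ofLex i).1) then (1 : k) else 0 := by
  ext l i
  rw [coe_reindexGL, Matrix.submatrix_apply, swapGL_apply, Matrix.of_apply]
  have hsymm : ∀ x : MatIdx m, (matIdxEquiv m).symm x = finProdFinEquiv (ofLex x) := by
    intro x
    apply (matIdxEquiv m).injective
    rw [OrderIso.apply_symm_apply, matIdxEquiv_apply, Equiv.symm_apply_apply]
    rfl
  rw [hsymm, hsymm, letterSwap_finProdFinEquiv]
  have hl : finProdFinEquiv (ofLex l).swap = finProdFinEquiv (ofLex i) ↔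
      l = toLex ((ofLex i).2, (ofLex i).1) := by
    rw [finProdFinEquiv.apply_eq_iff_eq]
    constructor
    · intro h
      have h' : ofLex l = ((ofLex i).2, (ofLex i).1) := by
        rw [← Prod.swap_swap (ofLex l), h]
        rfl
      exact congrArg toLex h'
    · rintro rfl
      rfl
  by_cases h : l = toLex ((ofLex i).2, (ofLex i).1)
  · rw [if_pos h, if_pos (hl.mpr h)]
  · rw [if_neg h, if_neg (fun h' => h (hl.mp h'))]

/-- `det (Xᵀ) = det X` for the generic matrix over any field: renaming along `Prod.swap` fixes
`detPoly`. [folklore] -/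
theorem rename_swap_detPoly_field (n : Type*) [Fintype n] [DecidableEq n] :
    rename Prod.swap (detPoly n k) = detPoly n k := by
  rw [detPoly, AlgHom.map_det]
  have : (rename (Prod.swap : n × n → n × n)).mapMatrix (Matrix.mvPolynomialX n n k)
      = (Matrix.mvPolynomialX n n k)ᵀ := by
    ext i j : 1
    simp [Matrix.mvPolynomialX, rename_X]
  rw [this, Matrix.det_transpose]

/-- The permutation matrix of the transposition fixes `det_m` under `linSubst` (any field).
[folklore] -/
theorem linSubst_swapMatrix_detFormLex_field :
    linSubst (MatIdx m) k
        (Matrix.of fun l i : MatIdx m => if l = toLex ((ofLex i).2, (ofLex i).1) then (1 : k) else 0)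
        (detFormLex k m) = detFormLex k m := by
  have hsum : ∀ {N : Type _} [AddCommMonoid N] [Module k N] (f : MatIdx m → N) (i : MatIdx m),
      ∑ l : MatIdx m, (Matrix.of fun l i : MatIdx m =>
        if l = toLex ((ofLex i).2, (ofLex i).1) then (1 : k) else 0) l i • f l =
          f (toLex ((ofLex i).2, (ofLex i).1)) := by
    intro N _ _ f i
    simp [Matrix.of_apply, ite_smul, Finset.sum_ite_eq']
  have hls : linSubst (MatIdx m) k
      (Matrix.of fun l i : MatIdx m => if l = toLex ((ofLex i).2, (ofLex i).1) then (1 : k) else 0)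
        = rename (fun i : MatIdx m => toLex ((ofLex i).2, (ofLex i).1)) := by
    refine MvPolynomial.algHom_ext fun i => ?_
    rw [linSubst_X, hsum, rename_X]
  rw [hls, detFormLex, rename_rename]
  have : ((fun i : MatIdx m => toLex ((ofLex i).2, (ofLex i).1)) ∘ toLex : Fin m × Fin m → MatIdx m)
      = toLex ∘ Prod.swap := by
    funext ⟨a, b⟩; rfl
  rw [this, ← rename_rename, rename_swap_detPoly_field]

/-- **The transpose stabilises `det_m`**: `swapGL`, reindexed to the lexicographic matrix variables,
fixes `detFormLex k m` (BLMW 2011 §5.2: `ℤ/2 ⊂ GL(W)(det_n)`). [folklore] -/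
theorem linSubstRep_reindexGL_swapGL_detFormLex :
    linSubstRep (MatIdx m) k (reindexGL (k := k) (matIdxEquiv m) (swapGL m k)) (detFormLex k m) =
      detFormLex k m := by
  rw [linSubstRep_apply, coe_reindexGL_swapGL, linSubst_swapMatrix_detFormLex_field]

/-- Every element of the enlarged family stabilises `det_m`. [folklore] -/
theorem linSubstRep_reindexGL_detFormLex_of_kron_or_swap {h : GL (Fin (m * m)) k}
    (hh : IsKronUnimodularBorel k m h ∨ h = swapGL m k) :
    linSubstRep (MatIdx m) k (reindexGL (k := k) (matIdxEquiv m) h) (detFormLex k m) =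
      detFormLex k m := by
  rcases hh with ⟨a, b, -, ha1, -, hb1, rfl⟩ | rfl
  · exact linSubstRep_reindexGL_kronFin_detFormLex k m ha1 hb1
  · exact linSubstRep_reindexGL_swapGL_detFormLex k m

end Det

/-! ## §4 The multiplicity bound (registered sub-goal; header on one line for the stub registry) -/

/-- **`K_m(λ*) ≤ dim boundSpace(λ*, symKronInvariants)`** (any field of characteristic zero): the
multiplicity of `λ*` in `k[Δ(det_m)]` is at most the dimension of the bound space of
`𝔖_{mδ}`-invariant coefficient matrices with columns in the transposed weight space of `λ*` and rows
in the SYMMETRIC Kronecker invariants — `finrank_highestWeightSpace_orbitCoordRep_le` with the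
stabilising family enlarged by the transpose. This is BLMW's
`mult_λ ℂ[Δ(det)] ≤ dim (S_λ W)^{Stab(det)}` with `Stab(det)` cut down to
`(B_{SL(E)} × B_{SL(F)}) ⋊ ℤ/2` instead of `B_{SL(E)} × B_{SL(F)}`. [BLMW 2011 §5.2 Prop. 5.2.1] -/
theorem orbitMultiplicity_det_le_finrank_symBoundSpace (k : Type*) [Field k] [CharZero k] (m : ℕ) {δ : ℕ} (lam : Nat.Partition (m * δ)) (hlam : lam.parts.card ≤ m * m) : orbitMultiplicity k (detFormLex k m) m ((Weight.dualOfPartition (m * m) lam).toMatIdx : Weight (MatIdx m)) ≤ Module.finrank k (boundSpace k (Weight.dualOfPartition (m * m) lam) (symKronInvariants k m (m * δ))) := by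
  have hle := finrank_highestWeightSpace_orbitCoordRep_le (detFormLex k m) m
    ((Weight.dualOfPartition (m * m) lam).toMatIdx : Weight (MatIdx m)) (matIdxEquiv m)
    (size_toMatIdx_dualOfPartition m lam hlam)
    (symKronInvariants k m (m * δ)) (fun h => IsKronUnimodularBorel k m h ∨ h = swapGL m k)
    mem_symKronInvariants_of_forall
    (fun h hh => linSubstRep_reindexGL_detFormLex_of_kron_or_swap k m hh)
  rw [toMatIdx_comp_matIdxEquiv] at hle
  exact hle



end

end Summit.ValiantsHypothesis.ValiantsHypothesis.Theorems.ValuativeFlip
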